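import Mathlib
import Literature.NumberTheory.LFunctions.PeriodicDirichletSeriesSmoothPartLimit
import Literature.NumberTheory.LFunctions.GeneralizedEulerConstants
import HarnessLib

/-!
# Euler sums over `M(P)` and the fibres of `m ↦ gcd(m, q)` on `M(q)` (for Okada's criterion in prime form)

Topic `Literature/NumberTheory/LFunctions`; namespace `Literature.NumberTheory.LFunctions.ChatterjeeMurty2014`.
THEOREMS only (no definition, no named fact, no `sorry`); cell pub-zeta5, P1 g58. Arithmetic/analytic input for the
second condition of OKADA'S CRITERION in its printed «`ε(r,p)`» form (the sequel
`Literature/NumberTheory/Transcendental/OkadaCriterionPrimeFormProofs.lean`), along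

* T. Chatterjee, M. Ram Murty, *Non-vanishing of Dirichlet series with periodic coefficients*, JNT **145** (2014)
  [ChatterjeeMurty2014], §5 «Equivalence of Okada's criterion» (proof of Theorem 4, READ: «We write each `b₁` as
  `p^β c` with `c ∈ M(q₁)` where `q₁ = q/p^{v_p(q)}` … `Σ_{c₁∈M(q₁)} 1/c₁ = Π_{p₁∣q₁}(1 − 1/p₁)⁻¹ = q₁/φ(q₁)` …
  `Σ_{j≥v} jX^j = X^v/(1−X)·(X/(1−X) + v)`»);
* R. Tijdeman, *Some applications of Diophantine approximation* (2002) [Tijdeman2002], Appendix, Theorem 8 (READ):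
  the sets `P(d) = {p prime : p ∣ q, ord_p(d) ≥ ord_p(q)}` and `S(d)` indexing the finite form (5.4).

## What is proved (`M(P)` = Mathlib's `Nat.factoredNumbers P` for a finite set of primes `P`; `N ≥ 1`)

* `hasSum_factoredNumbers_cpow_neg` — `Σ_{n∈M(P)} n^{−s} = Π_{p∈P}(1 − p^{−s})⁻¹` for complex `re s > 0`
  (Mathlib's Euler product); the `M(P)`-supported Dirichlet series with bounded coefficients
  (`summable_factoredNumbers_rpow_neg'`, `…_cpow_mul'`, `…_div'`, `LSeriesSummable_indicator_factoredNumbers'`,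
  `LSeries_indicator_factoredNumbers_eq_tsum'`, `hasDerivAt_LSeries_indicator_factoredNumbers'` — the primed
  generalisations of the `N.primeFactors` versions of `PeriodicDirichletSeriesSmoothPart.lean`);
* **`tsum_factoredNumbers_log_div`** — `Σ_{n∈M(P)} (log n)/n = (Σ_{n∈M(P)} 1/n)·Σ_{p∈P} log p/(p−1)` (logarithmic
  derivative of the Euler product at `s = 1`, with P1 g57's `DiamondFord.hasDerivAt_prod_one_sub_cpow_neg`);
* **`mem_factoredNumbers_and_gcd_eq_iff`** — for `d ∣ N`: `m ∈ M(N)` has `gcd(m,N) = d` iff `m = d·n` with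
  `n ∈ M(P(d))`, `P(d)` = the primes of `N` not dividing `N/d`;
* `tsum_indicator_gcd_eq`, `tsum_indicator_gcd_inv_eq`, **`tsum_indicator_gcd_log_div_eq`** — the fibre sums
  `Σ_{gcd(m,N)=d} w(m) = Σ_{n∈M(P(d))} w(dn)`, `μ_d = Σ_{gcd(m,N)=d} 1/m = d⁻¹Σ_{n∈M(P(d))} 1/n`, and
  `Σ_{gcd(m,N)=d} (log m)/m = μ_d·(log d + Σ_{p∈P(d)} log p/(p−1))`.

HONEST FRAMING: elementary/analytic bookkeeping behind a printed 2014 equivalence; nothing here concerns `ζ(5)`.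
-/

noncomputable section

open Complex Finset Filter Topology

namespace Literature.NumberTheory.LFunctions

namespace ChatterjeeMurty2014

/-! ### Euler sums over `M(P)` for an arbitrary finite set of primes `P` -/

/-- **Euler product over `M(P)`, complex exponent**: for a finite set of primes `P` and `re s > 0`,
`Σ_{n∈M(P)} n^{−s} = Π_{p∈P} (1 − p^{−s})⁻¹` (absolutely convergent).
[cite: ChatterjeeMurty2014, §5 (proof of Theorem 4: «`Σ_{c₁∈M(q₁)} 1/c₁ = Π_{p₁∣q₁}(1 − 1/p₁)⁻¹`»)] -/
theorem hasSum_factoredNumbers_cpow_neg (P : Finset ℕ) (hP : ∀ p ∈ P, p.Prime) {s : ℂ} (hs : 0 < s.re) :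
    HasSum (fun n : Nat.factoredNumbers P => ((n : ℕ) : ℂ) ^ (-s)) (∏ p ∈ P, (1 - (p : ℂ) ^ (-s))⁻¹) := by
  let g : ℕ →* ℂ :=
    { toFun := fun n => (n : ℂ) ^ (-s)
      map_one' := by simp
      map_mul' := fun m n => by
        push_cast
        exact Complex.natCast_mul_natCast_cpow m n (-s) }
  have hg : ∀ {p : ℕ}, p.Prime → ‖g p‖ < 1 := by
    intro p hp
    have hp1 : (1 : ℝ) < p := by exact_mod_cast hp.one_lt
    show ‖(p : ℂ) ^ (-s)‖ < 1
    rw [Complex.norm_natCast_cpow_of_pos hp.pos, neg_re]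
    exact Real.rpow_lt_one_of_one_lt_of_neg hp1 (by linarith)
  have h := (EulerProduct.summable_and_hasSum_factoredNumbers_prod_filter_prime_geometric hg P).2
  have hfilter : P.filter (fun p => p.Prime) = P := Finset.filter_true_of_mem fun p hp => hP p hp
  rw [hfilter] at h
  exact h

/-- `Σ_{n∈M(P)} n^{−σ}` converges for `σ > 0` (real form). [cite: ChatterjeeMurty2014, §5] -/
theorem summable_factoredNumbers_rpow_neg' (P : Finset ℕ) (hP : ∀ p ∈ P, p.Prime) {σ : ℝ} (hσ : 0 < σ) :
    Summable (fun n : Nat.factoredNumbers P => ((n : ℕ) : ℝ) ^ (-σ)) := by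
  have h := (hasSum_factoredNumbers_cpow_neg P hP (s := (σ : ℂ)) (by simpa using hσ)).summable.norm
  refine h.congr fun n => ?_
  rw [Complex.norm_natCast_cpow_of_pos (Nat.pos_of_ne_zero n.2.1), neg_re, Complex.ofReal_re]

/-- `Σ_{n∈M(P)} n^{−s} c(n)` converges absolutely for bounded `c` and `re s > 0`. [cite: ChatterjeeMurty2014, §5] -/
theorem summable_factoredNumbers_cpow_mul' (P : Finset ℕ) (hP : ∀ p ∈ P, p.Prime) {c : ℕ → ℂ} {B : ℝ}
    (hc : ∀ n, ‖c n‖ ≤ B) {s : ℂ} (hs : 0 < s.re) :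
    Summable (fun n : Nat.factoredNumbers P => ((n : ℕ) : ℂ) ^ (-s) * c n) := by
  refine Summable.of_norm_bounded ((summable_factoredNumbers_rpow_neg' P hP hs).mul_right B) fun n => ?_
  rw [norm_mul, Complex.norm_natCast_cpow_of_pos (Nat.pos_of_ne_zero n.2.1), neg_re]
  exact mul_le_mul_of_nonneg_left (hc n) (Real.rpow_nonneg (Nat.cast_nonneg _) _)

/-- `Σ_{n∈M(P)} c(n)/n` converges absolutely for bounded `c`. [cite: ChatterjeeMurty2014, §5] -/
theorem summable_factoredNumbers_div' (P : Finset ℕ) (hP : ∀ p ∈ P, p.Prime) {c : ℕ → ℂ} {B : ℝ}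
    (hc : ∀ n, ‖c n‖ ≤ B) : Summable (fun n : Nat.factoredNumbers P => c n / ((n : ℕ) : ℂ)) := by
  have h := summable_factoredNumbers_cpow_mul' P hP hc (s := 1) (by simp)
  simp_rw [cpow_neg_one, ← div_eq_inv_mul] at h
  exact h

set_option maxHeartbeats 400000 in
/-- The `M(P)`-supported Dirichlet series with bounded coefficients converges absolutely for `re s > 0`.
[cite: ChatterjeeMurty2014, §5] -/
theorem LSeriesSummable_indicator_factoredNumbers' (P : Finset ℕ) (hP : ∀ p ∈ P, p.Prime) {c : ℕ → ℂ}
    {B : ℝ} (hc : ∀ n, ‖c n‖ ≤ B) {s : ℂ} (hs : 0 < s.re) :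
    LSeriesSummable ((Nat.factoredNumbers P).indicator c) s := by
  have hsum : Summable fun n : ℕ => B * (Nat.factoredNumbers P).indicator (fun n : ℕ => (n : ℝ) ^ (-s.re)) n :=
    (summable_subtype_iff_indicator.mp (summable_factoredNumbers_rpow_neg' P hP hs)).mul_left B
  refine Summable.of_norm_bounded hsum fun n => ?_
  by_cases hn : n ∈ Nat.factoredNumbers P
  · have hn0 : n ≠ 0 := hn.1
    rw [Set.indicator_of_mem hn, LSeries.term_of_ne_zero hn0, Set.indicator_of_mem hn, norm_div,
      Complex.norm_natCast_cpow_of_pos (Nat.pos_of_ne_zero hn0), Real.rpow_neg (Nat.cast_nonneg n),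
      div_eq_mul_inv]
    exact mul_le_mul_of_nonneg_right (hc n) (inv_nonneg.mpr (Real.rpow_nonneg (Nat.cast_nonneg n) _))
  · rw [Set.indicator_of_notMem hn, mul_zero]
    rcases eq_or_ne n 0 with rfl | hn0
    · rw [LSeries.term_zero, norm_zero]
    · rw [LSeries.term_of_ne_zero hn0, Set.indicator_of_notMem hn, zero_div, norm_zero]

/-- The value of an `M(P)`-supported Dirichlet series as a sum over `M(P)`. [cite: ChatterjeeMurty2014, §5] -/
theorem LSeries_indicator_factoredNumbers_eq_tsum' (P : Finset ℕ) (c : ℕ → ℂ) (s : ℂ) :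
    LSeries ((Nat.factoredNumbers P).indicator c) s =
      ∑' n : Nat.factoredNumbers P, ((n : ℕ) : ℂ) ^ (-s) * c n := by
  rw [LSeries, tsum_subtype (Nat.factoredNumbers P) (fun n : ℕ => ((n : ℕ) : ℂ) ^ (-s) * c n)]
  refine tsum_congr fun n => ?_
  by_cases hn : n ∈ Nat.factoredNumbers P
  · rw [Set.indicator_of_mem hn, LSeries.term_of_ne_zero hn.1, Set.indicator_of_mem hn, cpow_neg,
      div_eq_inv_mul]
  · rw [Set.indicator_of_notMem hn]
    rcases eq_or_ne n 0 with rfl | hn0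
    · rw [LSeries.term_zero]
    · rw [LSeries.term_of_ne_zero hn0, Set.indicator_of_notMem hn, zero_div]

/-- Term-wise differentiation of an `M(P)`-supported Dirichlet series at `s = 1`. [cite: ChatterjeeMurty2014, §5] -/
theorem hasDerivAt_LSeries_indicator_factoredNumbers' (P : Finset ℕ) (hP : ∀ p ∈ P, p.Prime) {c : ℕ → ℂ}
    {B : ℝ} (hc : ∀ n, ‖c n‖ ≤ B) :
    HasDerivAt (LSeries ((Nat.factoredNumbers P).indicator c))
      (-∑' n : Nat.factoredNumbers P, ((n : ℕ) : ℂ) ^ (-(1 : ℂ)) * (Complex.log n * c n)) 1 := by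
  have habs : LSeries.abscissaOfAbsConv ((Nat.factoredNumbers P).indicator c) < (1 : ℂ).re := by
    have h := (LSeriesSummable_indicator_factoredNumbers' P hP hc (s := (1 / 2 : ℂ))
      (by norm_num)).abscissaOfAbsConv_le
    refine lt_of_le_of_lt h ?_
    have h12 : ((1 / 2 : ℂ)).re = 1 / 2 := by norm_num
    rw [h12, Complex.one_re]
    exact_mod_cast (show (1 / 2 : ℝ) < 1 by norm_num)
  have h := LSeries_hasDerivAt habs
  have hlog : LSeries.logMul ((Nat.factoredNumbers P).indicator c) =
      (Nat.factoredNumbers P).indicator (fun n : ℕ => Complex.log n * c n) := by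
    funext n
    by_cases hn : n ∈ Nat.factoredNumbers P
    · rw [LSeries.logMul, Set.indicator_of_mem hn, Set.indicator_of_mem hn]
    · rw [LSeries.logMul, Set.indicator_of_notMem hn, Set.indicator_of_notMem hn, mul_zero]
  rwa [hlog, LSeries_indicator_factoredNumbers_eq_tsum'] at h

/-- **The logarithmic Euler sum**: for a finite set of primes `P`,
`Σ_{n∈M(P)} (log n)/n = (Σ_{n∈M(P)} 1/n) · Σ_{p∈P} log p/(p − 1)` — the logarithmic derivative at `s = 1` of
`Σ_{n∈M(P)} n^{−s} = Π_{p∈P}(1 − p^{−s})⁻¹` (with P1 g57's `DiamondFord.hasDerivAt_prod_one_sub_cpow_neg` /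
`sum_prod_erase_mul_eq` for the Euler factor). [cite: ChatterjeeMurty2014, §5 (proof of Theorem 4: the sums
`Σ_j j/p^j · Σ_{c∈M(q₁)} 1/c`)] -/
theorem tsum_factoredNumbers_log_div (P : Finset ℕ) (hP : ∀ p ∈ P, p.Prime) :
    ∑' n : Nat.factoredNumbers P, Complex.log ((n : ℕ) : ℂ) / ((n : ℕ) : ℂ) =
      (∑' n : Nat.factoredNumbers P, (1 : ℂ) / ((n : ℕ) : ℂ)) * ∑ p ∈ P, Complex.log p / ((p : ℂ) - 1) := by
  classical
  have hP0 : ∀ p ∈ P, p ≠ 0 := fun p hp => (hP p hp).ne_zero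
  have hP1 : ∀ p ∈ P, 1 < p := fun p hp => (hP p hp).one_lt
  -- `F = Σ n^{-s}` (as an L-series), `E = Π (1 - p^{-s})`
  set F : ℂ → ℂ := LSeries ((Nat.factoredNumbers P).indicator (fun _ => (1 : ℂ))) with hF
  set E : ℂ → ℂ := fun z => ∏ p ∈ P, (1 - (p : ℂ) ^ (-z)) with hE
  have hone : ∀ n : ℕ, ‖(fun _ : ℕ => (1 : ℂ)) n‖ ≤ 1 := fun n => by simp
  -- `F · E = 1` on `re z > 0`
  have hFE : ∀ z : ℂ, 0 < z.re → F z * E z = 1 := by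
    intro z hz
    have h1 : F z = ∑' n : Nat.factoredNumbers P, ((n : ℕ) : ℂ) ^ (-z) := by
      rw [hF, LSeries_indicator_factoredNumbers_eq_tsum']
      exact tsum_congr fun n => mul_one _
    rw [h1, (hasSum_factoredNumbers_cpow_neg P hP hz).tsum_eq, hE, ← Finset.prod_mul_distrib]
    refine Finset.prod_eq_one fun p hp => inv_mul_cancel₀ ?_
    have hp1 : (1 : ℝ) < p := by exact_mod_cast hP1 p hp
    have hlt : ‖(p : ℂ) ^ (-z)‖ < 1 := by
      rw [Complex.norm_natCast_cpow_of_pos (hP p hp).pos, neg_re]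
      exact Real.rpow_lt_one_of_one_lt_of_neg hp1 (by linarith)
    intro h
    rw [sub_eq_zero] at h
    rw [← h, norm_one] at hlt
    exact lt_irrefl _ hlt
  -- derivatives at `1`
  have hdF := hasDerivAt_LSeries_indicator_factoredNumbers' P hP hone
  have hdE := DiamondFord.hasDerivAt_prod_one_sub_cpow_neg P hP0 1
  have hdFE := hdF.mul hdE
  have hconst : HasDerivAt (fun z : ℂ => F z * E z) 0 1 := by
    refine (hasDerivAt_const (1 : ℂ) (1 : ℂ)).congr_of_eventuallyEq ?_
    have hopen : IsOpen {z : ℂ | 0 < z.re} := isOpen_lt continuous_const Complex.continuous_re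
    filter_upwards [hopen.mem_nhds (show (1 : ℂ) ∈ {z : ℂ | 0 < z.re} by simp)] with z hz
    exact hFE z hz
  have hzero := hdFE.unique hconst
  -- evaluate: `E(1) = δ_P ≠ 0`, `E'(1) = δ_P Σ log p/(p−1)`
  have hE1 : E 1 = ∏ p ∈ P, (1 - (p : ℂ)⁻¹) := Finset.prod_congr rfl fun p _ => by rw [cpow_neg_one]
  have hE1ne : E 1 ≠ 0 := by
    rw [hE1]
    refine Finset.prod_ne_zero_iff.mpr fun p hp => ?_
    have hpC : (p : ℂ) ≠ 0 := by exact_mod_cast hP0 p hp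
    have hp1C : (p : ℂ) ≠ 1 := by exact_mod_cast (hP1 p hp).ne'
    rw [sub_ne_zero, ne_comm, Ne, inv_eq_one]
    exact hp1C
  have hE' : ∑ p ∈ P, (∏ q ∈ P.erase p, (1 - (q : ℂ) ^ (-(1 : ℂ)))) * ((p : ℂ) ^ (-(1 : ℂ)) * Complex.log p) =
      (∏ p ∈ P, (1 - (p : ℂ)⁻¹)) * ∑ p ∈ P, Complex.log p / ((p : ℂ) - 1) := by
    rw [← DiamondFord.sum_prod_erase_mul_eq P hP1]
    refine Finset.sum_congr rfl fun p _ => ?_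
    rw [cpow_neg_one]
    congr 1
    exact Finset.prod_congr rfl fun q _ => by rw [cpow_neg_one]
  have hprod : ∏ p ∈ P, (1 - (p : ℂ) ^ (-(1 : ℂ))) = ∏ p ∈ P, (1 - (p : ℂ)⁻¹) :=
    Finset.prod_congr rfl fun p _ => by rw [cpow_neg_one]
  rw [hE', hprod] at hzero
  -- `F(1) = Σ 1/n`, `F'(1) = −Σ log n / n`
  have hF1 : LSeries ((Nat.factoredNumbers P).indicator (fun _ => (1 : ℂ))) 1 =
      ∑' n : Nat.factoredNumbers P, (1 : ℂ) / ((n : ℕ) : ℂ) := by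
    rw [LSeries_indicator_factoredNumbers_eq_tsum']
    exact tsum_congr fun n => by rw [cpow_neg_one, mul_one, one_div]
  have hT : ∑' n : Nat.factoredNumbers P, ((n : ℕ) : ℂ) ^ (-(1 : ℂ)) * (Complex.log ((n : ℕ) : ℂ) * 1) =
      ∑' n : Nat.factoredNumbers P, Complex.log ((n : ℕ) : ℂ) / ((n : ℕ) : ℂ) :=
    tsum_congr fun n => by rw [cpow_neg_one, mul_one, div_eq_inv_mul]
  rw [hT, hF1] at hzero
  -- solve the linear equation `−T·δ + F(1)·δ·Σ = 0`
  have hδ : (∏ p ∈ P, (1 - (p : ℂ)⁻¹)) ≠ 0 := by rwa [hE1] at hE1ne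
  apply mul_right_cancel₀ hδ
  linear_combination -hzero


/-- `Σ_{n∈M(P)} (log n)/n` converges absolutely (`log n ≤ 2√n`). [cite: ChatterjeeMurty2014, §5 (proof of Theorem 4)] -/
theorem summable_factoredNumbers_log_div' (P : Finset ℕ) (hP : ∀ p ∈ P, p.Prime) :
    Summable (fun n : Nat.factoredNumbers P => Complex.log ((n : ℕ) : ℂ) / ((n : ℕ) : ℂ)) := by
  have h := (summable_factoredNumbers_rpow_neg' P hP (σ := 1 / 2) (by norm_num)).mul_left 2
  refine Summable.of_norm_bounded h fun n => ?_
  have hn : 0 < ((n : ℕ) : ℝ) := by exact_mod_cast Nat.pos_of_ne_zero n.2.1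
  rw [norm_div, Complex.norm_natCast, ← Complex.natCast_log, Complex.norm_real, Real.norm_eq_abs,
    abs_of_nonneg (Real.log_natCast_nonneg _), div_le_iff₀ hn]
  have hlog := Real.log_le_rpow_div hn.le (show (0 : ℝ) < 1 / 2 by norm_num)
  have hneg : ((n : ℕ) : ℝ) ^ (-(1 / 2 : ℝ)) * ((n : ℕ) : ℝ) = ((n : ℕ) : ℝ) ^ (1 / 2 : ℝ) := by
    conv_lhs => rw [show ((n : ℕ) : ℝ) ^ (-(1 / 2 : ℝ)) * ((n : ℕ) : ℝ) =
      ((n : ℕ) : ℝ) ^ (-(1 / 2 : ℝ)) * ((n : ℕ) : ℝ) ^ (1 : ℝ) by rw [Real.rpow_one]]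
    rw [← Real.rpow_add hn]
    norm_num
  calc Real.log ((n : ℕ) : ℝ) ≤ ((n : ℕ) : ℝ) ^ (1 / 2 : ℝ) / (1 / 2) := hlog
    _ = 2 * ((n : ℕ) : ℝ) ^ (-(1 / 2 : ℝ)) * ((n : ℕ) : ℝ) := by rw [mul_assoc, hneg]; ring

/-! ### The fibres of `m ↦ gcd(m, N)` on `M(N)` -/

variable {N : ℕ} [NeZero N]

/-- **The fibre of `gcd(·, N)` over a divisor `d`**: for `d ∣ N`, an `M(N)`-number `m` has `gcd(m, N) = d` iff
`m = d·n` with `n` composed of the primes `p ∣ N` NOT dividing `N/d` (the primes at which `d` carries the full power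
of `N`; Tijdeman's set `P(d)`). [cite: Tijdeman2002, Appendix, Theorem 8 (the sets `P(d)`, `S(d)`)] -/
theorem mem_factoredNumbers_and_gcd_eq_iff {d : ℕ} (hd : d ∣ N) (m : ℕ) :
    (m ∈ Nat.factoredNumbers N.primeFactors ∧ Nat.gcd m N = d) ↔
      ∃ n ∈ Nat.factoredNumbers (N.primeFactors.filter (fun p => ¬ p ∣ N / d)), m = d * n := by
  have hN : N ≠ 0 := NeZero.ne N
  have hd0 : d ≠ 0 := fun h => hN (by rw [h] at hd; exact zero_dvd_iff.mp hd)
  have hNd : d * (N / d) = N := Nat.mul_div_cancel' hd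
  constructor
  · rintro ⟨hm, hg⟩
    have hdm : d ∣ m := hg ▸ Nat.gcd_dvd_left m N
    refine ⟨m / d, ?_, (Nat.mul_div_cancel' hdm).symm⟩
    have hcop : Nat.Coprime (m / d) (N / d) := by
      have h := Nat.coprime_div_gcd_div_gcd (m := m) (n := N) (by rw [hg]; exact Nat.pos_of_ne_zero hd0)
      rwa [hg] at h
    have hmd : m / d ∈ Nat.factoredNumbers N.primeFactors :=
      Nat.mem_factoredNumbers_of_dvd hm (Nat.div_dvd_of_dvd hdm)
    refine Nat.mem_factoredNumbers'.mpr fun p hp hpd => Finset.mem_filter.mpr ⟨?_, fun h => ?_⟩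
    · exact Nat.mem_factoredNumbers'.mp hmd p hp hpd
    · exact hp.ne_one ((Nat.coprime_iff_gcd_eq_one.mp hcop) ▸ Nat.dvd_gcd hpd h |> Nat.dvd_one.mp)
  · rintro ⟨n, hn, rfl⟩
    have hdM : d ∈ Nat.factoredNumbers N.primeFactors :=
      Nat.mem_factoredNumbers_of_dvd
        (Nat.mem_factoredNumbers_iff_primeFactors_subset.mpr ⟨hN, Finset.Subset.refl _⟩) hd
    have hnM : n ∈ Nat.factoredNumbers N.primeFactors :=
      Nat.factoredNumbers_mono (Finset.filter_subset _ _) hn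
    refine ⟨Nat.mul_mem_factoredNumbers hdM hnM, ?_⟩
    have hcop : Nat.Coprime n (N / d) :=
      Nat.coprime_of_dvd fun k hk hkn hkN =>
        (Finset.mem_filter.mp (Nat.mem_factoredNumbers'.mp hn k hk hkn)).2 hkN
    conv_lhs => rw [← hNd]
    rw [Nat.gcd_mul_left, Nat.coprime_iff_gcd_eq_one.mp hcop, mul_one]

/-- **Fibre sums**: for `d ∣ N` and any `w`, `Σ_{m∈M(N), gcd(m,N)=d} w(m) = Σ_{n∈M(P(d))} w(dn)`.
[cite: Tijdeman2002, Appendix, Theorem 8 (the inner sums over `S(d)`)] -/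
theorem tsum_indicator_gcd_eq {d : ℕ} (hd : d ∣ N) (w : ℕ → ℂ) :
    ∑' m : Nat.factoredNumbers N.primeFactors, (if Nat.gcd (m : ℕ) N = d then w m else 0) =
      ∑' n : Nat.factoredNumbers (N.primeFactors.filter (fun p => ¬ p ∣ N / d)), w (d * n) := by
  classical
  let ι : Nat.factoredNumbers (N.primeFactors.filter (fun p => ¬ p ∣ N / d)) →
      Nat.factoredNumbers N.primeFactors :=
    fun n => ⟨d * n, ((mem_factoredNumbers_and_gcd_eq_iff hd (d * n)).mpr ⟨n, n.2, rfl⟩).1⟩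
  have hd0 : d ≠ 0 := fun h => (NeZero.ne N) (by rw [h] at hd; exact zero_dvd_iff.mp hd)
  have hι : Function.Injective ι := by
    rintro ⟨n₁, _⟩ ⟨n₂, _⟩ h
    have h' : d * n₁ = d * n₂ := congrArg Subtype.val h
    exact Subtype.ext (Nat.eq_of_mul_eq_mul_left (Nat.pos_of_ne_zero hd0) h')
  have hsupp : Function.support (fun m : Nat.factoredNumbers N.primeFactors =>
      if Nat.gcd (m : ℕ) N = d then w m else 0) ⊆ Set.range ι := by
    intro m hm
    rw [Function.mem_support] at hm
    have hg : Nat.gcd (m : ℕ) N = d := by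
      by_contra h
      exact hm (if_neg h)
    obtain ⟨n, hn, hmn⟩ := (mem_factoredNumbers_and_gcd_eq_iff hd (m : ℕ)).mp ⟨m.2, hg⟩
    exact ⟨⟨n, hn⟩, Subtype.ext hmn.symm⟩
  rw [← hι.tsum_eq hsupp]
  refine tsum_congr fun n => ?_
  have hg : Nat.gcd (d * (n : ℕ)) N = d := ((mem_factoredNumbers_and_gcd_eq_iff hd (d * n)).mpr ⟨n, n.2, rfl⟩).2
  simp only [ι, hg, if_true]

/-- The fibre masses `μ_d = Σ_{m∈M(N), gcd(m,N)=d} 1/m = d⁻¹ · Σ_{n∈M(P(d))} 1/n` (Tijdeman's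
`d⁻¹ Π_{p∈P(d)}(1 − 1/p)⁻¹`). [cite: Tijdeman2002, Appendix, Theorem 8] -/
theorem tsum_indicator_gcd_inv_eq {d : ℕ} (hd : d ∣ N) :
    ∑' m : Nat.factoredNumbers N.primeFactors, (if Nat.gcd (m : ℕ) N = d then (1 : ℂ) / ((m : ℕ) : ℂ) else 0) =
      (1 : ℂ) / d * ∑' n : Nat.factoredNumbers (N.primeFactors.filter (fun p => ¬ p ∣ N / d)),
        (1 : ℂ) / ((n : ℕ) : ℂ) := by
  rw [tsum_indicator_gcd_eq hd (fun m : ℕ => (1 : ℂ) / (m : ℂ)), ← tsum_mul_left]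
  refine tsum_congr fun n => ?_
  push_cast
  rw [one_div_mul_one_div]

/-- **The logarithmic fibre sums**: for `d ∣ N`, with `P(d)` = the primes of `N` not dividing `N/d`,
`Σ_{m∈M(N), gcd(m,N)=d} (log m)/m = μ_d · (log d + Σ_{p∈P(d)} log p/(p − 1))` where
`μ_d = Σ_{m∈M(N), gcd(m,N)=d} 1/m` (the logarithmic derivative of `d^{−s}Π_{p∈P(d)}(1 − p^{−s})⁻¹`).
[cite: ChatterjeeMurty2014, §5 (proof of Theorem 4)] [cite: Tijdeman2002, Appendix, Theorem 8] -/
theorem tsum_indicator_gcd_log_div_eq {d : ℕ} (hd : d ∣ N) :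
    ∑' m : Nat.factoredNumbers N.primeFactors,
        (if Nat.gcd (m : ℕ) N = d then Complex.log ((m : ℕ) : ℂ) / ((m : ℕ) : ℂ) else 0) =
      (∑' m : Nat.factoredNumbers N.primeFactors,
          (if Nat.gcd (m : ℕ) N = d then (1 : ℂ) / ((m : ℕ) : ℂ) else 0)) *
        (Complex.log d + ∑ p ∈ N.primeFactors.filter (fun p => ¬ p ∣ N / d), Complex.log p / ((p : ℂ) - 1)) := by
  have hP : ∀ p ∈ N.primeFactors.filter (fun p => ¬ p ∣ N / d), p.Prime := fun p hp =>
    Nat.prime_of_mem_primeFactors (Finset.mem_filter.mp hp).1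
  have hd0 : d ≠ 0 := fun h => (NeZero.ne N) (by rw [h] at hd; exact zero_dvd_iff.mp hd)
  have hdC : (d : ℂ) ≠ 0 := by exact_mod_cast hd0
  rw [tsum_indicator_gcd_inv_eq hd, tsum_indicator_gcd_eq hd (fun m : ℕ => Complex.log (m : ℂ) / (m : ℂ))]
  -- `log(dn)/(dn) = (log d)/(dn) + (log n)/(dn)`
  have hsplit : ∀ n : Nat.factoredNumbers (N.primeFactors.filter (fun p => ¬ p ∣ N / d)),
      Complex.log ((d * (n : ℕ) : ℕ) : ℂ) / ((d * (n : ℕ) : ℕ) : ℂ) =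
        (1 : ℂ) / d * (Complex.log d * ((1 : ℂ) / ((n : ℕ) : ℂ))) +
          (1 : ℂ) / d * (Complex.log ((n : ℕ) : ℂ) / ((n : ℕ) : ℂ)) := by
    intro n
    have hn : 0 < ((n : ℕ) : ℝ) := by exact_mod_cast Nat.pos_of_ne_zero n.2.1
    have hdpos : 0 < (d : ℝ) := by exact_mod_cast Nat.pos_of_ne_zero hd0
    have hnC : ((n : ℕ) : ℂ) ≠ 0 := by exact_mod_cast n.2.1
    have hlog : Complex.log ((d * (n : ℕ) : ℕ) : ℂ) = Complex.log d + Complex.log ((n : ℕ) : ℂ) := by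
      rw [← Complex.natCast_log, ← Complex.natCast_log, ← Complex.natCast_log]
      push_cast
      rw [Real.log_mul hdpos.ne' hn.ne']
      push_cast
      ring
    rw [hlog]
    push_cast
    field_simp
  have h1 : Summable fun n : Nat.factoredNumbers (N.primeFactors.filter (fun p => ¬ p ∣ N / d)) =>
      (1 : ℂ) / d * (Complex.log d * ((1 : ℂ) / ((n : ℕ) : ℂ))) :=
    ((summable_factoredNumbers_div' _ hP (c := fun _ : ℕ => (1 : ℂ)) (B := 1) (fun n => by simp)).mul_left
      (Complex.log d)).mul_left _
  have h2 : Summable fun n : Nat.factoredNumbers (N.primeFactors.filter (fun p => ¬ p ∣ N / d)) =>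
      (1 : ℂ) / d * (Complex.log ((n : ℕ) : ℂ) / ((n : ℕ) : ℂ)) :=
    (summable_factoredNumbers_log_div' _ hP).mul_left _
  rw [tsum_congr hsplit, h1.tsum_add h2, tsum_mul_left, tsum_mul_left, tsum_mul_left,
    tsum_factoredNumbers_log_div _ hP]
  ring

end ChatterjeeMurty2014

end Literature.NumberTheory.LFunctions

end
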